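import Summits.QuantumFields.BalabanUV.Beta.FP.ResidualModeIdentities

/-!
# `BalabanUV.Beta.FP.ResidualModeDeterminant` — road «FP» for binder row D1, row H′2-IR ∕ IR-3, sub-row **IR-3-ID part 2**: the
# residual-mode DETERMINANT and the one-loop functional `logZ` in square-root-free letters (the owner's asks l.22118 ∕ E-FP-5-5 l.22150)

HONEST DEPENDENCY (page 1, mandatory): continuum YM on T⁴ ⇐ BetaPertH ∧ nine spine estimates (0/9 proved); BetaPertH ⇐ (D1) ∧ (D4) ∧
CAP+tail; G-an2-4 gates asym, D1 and NE2/3/4.  HONEST FRAMING (cell contract, verbatim): «discharging `BetaPertH` makes Bałaban's UV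
stability UNCONDITIONAL — a real constructive-QFT result; it is NOT the continuum limit and NOT the Clay problem.»  THIS MODULE is [folklore]
finite-dimensional linear algebra (`𝕜` a field; `ℝ` for the `log` forms) on the cell's own dictionary (`Beta.Composition.kkt ∕ blockProp ∕
det_kkt' ∕ logZ`, `Beta.CompositionSingular.flucCov`) and the landed `FP/ReGaugedShotDeterminant.logZ_downdate` (owner, p235350) +
`FP/ResidualModeIdentities.det_kkt_sub_deficit ∕ weight_sub_deficitCov_eq` (part 1) BY NAME; MODEL level; no `def`, no `def … : Prop`, nothing
cited, 0 `sorry`; 0 estimates; 0∕4 binders of row D1; NOT the ghost side (`GhostDeterminantModel`'s Gram constants), NOT IR-3-ELL ∕ LOC ∕ RG, NOT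
hbook, NOT hasym, NOT D1, NOT BetaPertH, NOT continuum, NOT Clay.

ABSOLUTE RULE (cell charter, verbatim): «No internally-minted statement may enter as a cited fact. Every hypothesis is either kernel-proved in this
package or a verbatim quotation of a PUBLISHED theorem with page reference. The manuscript(s) under audit are NOT citable for their own disputed
steps — they are the thing under adjudication; programme-internal (2001/route/tribunal) claims are never citable.»

CONTENT (letters of part 1: raw deficit rows `F`, weight `Mid` with `F H⁻¹ Fᵀ = Mid` in the reading, `Γ₀ := flucCov H Q`, `K_C⁻¹ := Mid − FΓ₀Fᵀ`;
the memo's whitened `E := N·F`, `N Mid Nᵀ = 1`, `M_B := 1 − EΓ₀Eᵀ`).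
* §1 WHITENED vs RAW DETERMINANT: `N Mid Nᵀ = 1 ⟹ det(1 − (NF)·X·(NF)ᵀ)·det Mid = det(Mid − F·X·Fᵀ)` for ANY `X` (at `X := Γ₀`:
  **`det M_B · det Mid = det K_C⁻¹`**), and over `ℝ` **`log|det M_B| = log|det(Mid − FΓ₀Fᵀ)| − log|det Mid|`** (the ask of l.22118).
* §2 THE ONE-LOOP FUNCTIONAL, NO WHITENING: from part 1's `det Mid·det kkt (H − FᵀMid⁻¹F) Q = det kkt H Q·det(Mid − FΓ₀Fᵀ)`,
  **`logZ (H − FᵀMid⁻¹F) Q = logZ H Q − ½log|det(Mid − FΓ₀Fᵀ)| + ½log|det Mid|`** (`IsUnit (kkt H Q).det`, `IsUnit Mid.det`,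
  `IsUnit (Mid − FΓ₀Fᵀ).det`); the same through the owner's whitened `logZ_downdate` at `E := NF` (agreement of the two routes); the
  THREE-PLUS-ONE-TERM form for invertible `H` (`det_kkt'`): `= c − ½log|det H| − ½log|det(QH⁻¹Qᵀ)| − ½log|det(Mid − FΓ₀Fᵀ)| + ½log|det Mid|`.
* §3 E-FP-5-5's one line: `det(Mid·L·Mid) = det Mid²·det L`, `log|det(Mid·L·Mid)| = 2log|det Mid| + log|det L|`, hence for a factorisation
  `Mid − FΓ₀Fᵀ = Mid·L·Mid` (the reading's `L = L_C`): **`logZ (H − FᵀMid⁻¹F) Q = logZ H Q − ½log|det L| − ½log|det Mid|`** — the `−½log det Mid`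
  that the constrained ghost's `+½log det Mid` cancels (E-FP-5-5 (1); the ghost side is NOT here).
Provenance: NE9 formalisation swarm (idle-seat cross-lane duty NE9 → road FP), unit b2b-balaban-t4-ne9-formalise-leaf-08 gen 28
(prover-b2b-balaban-t4-ne9-formalise-leaf-08-g28-0), 2026-08-20.  [folklore], 0 def, 0 cite, 0 sorry.
-/

namespace Summit.QuantumFields.BalabanUV.Beta.FP.ResidualModeDeterminant

open scoped Matrix
open Matrix
open Literature.MathematicalPhysics.QuantumFieldTheory.Balaban1983to89.Beta.Composition (kkt blockProp det_kkt' logZ)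
open Literature.MathematicalPhysics.QuantumFieldTheory.Balaban1983to89.Beta.CompositionSingular (flucCov)
open Summit.QuantumFields.BalabanUV.Beta.FP.ReGaugedShotDeterminant (logZ_downdate)
open Summit.QuantumFields.BalabanUV.Beta.FP.ResidualModeIdentities (det_kkt_sub_deficit weight_sub_deficitCov_eq)

variable {𝕜 : Type*} [Field 𝕜]
variable {κ ν μ : Type*} [Fintype κ] [Fintype ν] [Fintype μ] [DecidableEq κ] [DecidableEq ν] [DecidableEq μ]

/-! ## §1 The whitened residual-mode determinant in raw letters -/

omit [DecidableEq ν] in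
/-- [folklore] **`det M_B · det Mid = det K_C⁻¹`**: for a square whitening `N` with `N Mid Nᵀ = 1` and ANY `X : Matrix ν ν 𝕜`,
`det (1 − (NF)·X·(NF)ᵀ) · det Mid = det (Mid − F·X·Fᵀ)` (since `1 − NFXFᵀNᵀ = N·(Mid − FXFᵀ)·Nᵀ` and `det N²·det Mid = 1`). -/
theorem det_one_sub_whiten_mul (F : Matrix κ ν 𝕜) (X : Matrix ν ν 𝕜) (Mid N : Matrix κ κ 𝕜) (hN : N * Mid * Nᵀ = 1) :
    (1 - (N * F) * X * (N * F)ᵀ).det * Mid.det = (Mid - F * X * Fᵀ).det := by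
  have h1 : 1 - (N * F) * X * (N * F)ᵀ = N * (Mid - F * X * Fᵀ) * Nᵀ := by
    rw [Matrix.mul_sub, Matrix.sub_mul, hN]; simp only [Matrix.mul_assoc, transpose_mul]
  have hdet : N.det * Mid.det * N.det = 1 := by
    have h := congrArg Matrix.det hN
    rwa [det_mul, det_mul, det_transpose, det_one] at h
  rw [h1, det_mul, det_mul, det_transpose]
  calc N.det * (Mid - F * X * Fᵀ).det * N.det * Mid.det = (N.det * Mid.det * N.det) * (Mid - F * X * Fᵀ).det := by ring
    _ = (Mid - F * X * Fᵀ).det := by rw [hdet, one_mul]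

omit [DecidableEq ν] in
/-- [folklore] **THE ASK OF l.22118** (`log` form over `ℝ`): `N Mid Nᵀ = 1`, `IsUnit (Mid − FXFᵀ).det ⟹
log|det(1 − (NF)X(NF)ᵀ)| = log|det(Mid − FXFᵀ)| − log|det Mid|` — at `X := flucCov H Q`: `log|det M_B| = log|det K_C⁻¹| − log|det Mid|`. -/
theorem log_abs_det_one_sub_whiten (F : Matrix κ ν ℝ) (X : Matrix ν ν ℝ) (Mid N : Matrix κ κ ℝ) (hN : N * Mid * Nᵀ = 1)
    (hX : IsUnit (Mid - F * X * Fᵀ).det) :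
    Real.log |(1 - (N * F) * X * (N * F)ᵀ).det| = Real.log |(Mid - F * X * Fᵀ).det| - Real.log |Mid.det| := by
  have hMid : Mid.det ≠ 0 := by
    intro h0
    have h := congrArg Matrix.det hN
    rw [det_mul, det_mul, h0, mul_zero, zero_mul, det_one] at h
    exact zero_ne_one h
  have hD : (1 - (N * F) * X * (N * F)ᵀ).det = (Mid - F * X * Fᵀ).det / Mid.det := by
    rw [eq_div_iff hMid]; exact det_one_sub_whiten_mul F X Mid N hN
  rw [hD, abs_div, Real.log_div (abs_ne_zero.mpr hX.ne_zero) (abs_ne_zero.mpr hMid)]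

/-! ## §2 The one-loop functional of the covariant inner slice, square-root-free -/

/-- [folklore] **`logZ` OF THE WEIGHTED-DOWNDATED SYSTEM, NO WHITENING**: with `Γ₀ := flucCov H Q`,
`logZ (H − FᵀMid⁻¹F) Q = logZ H Q − ½·log|det(Mid − FΓ₀Fᵀ)| + ½·log|det Mid|` (from part 1's `det_kkt_sub_deficit`). -/
theorem logZ_sub_deficit (H : Matrix ν ν ℝ) (Q : Matrix μ ν ℝ) (F : Matrix κ ν ℝ) (Mid : Matrix κ κ ℝ) (h : IsUnit (kkt H Q).det)
    (hMid : IsUnit Mid.det) (hK : IsUnit (Mid - F * flucCov H Q * Fᵀ).det) :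
    logZ (H - Fᵀ * Mid⁻¹ * F) Q
      = logZ H Q - (1 / 2 : ℝ) * Real.log |(Mid - F * flucCov H Q * Fᵀ).det| + (1 / 2 : ℝ) * Real.log |Mid.det| := by
  have hD : (kkt (H - Fᵀ * Mid⁻¹ * F) Q).det = (kkt H Q).det * (Mid - F * flucCov H Q * Fᵀ).det / Mid.det := by
    rw [eq_div_iff hMid.ne_zero, mul_comm]; exact det_kkt_sub_deficit H Q F Mid h hMid
  unfold logZ
  rw [hD, abs_div, abs_mul,
    Real.log_div (mul_ne_zero (abs_ne_zero.mpr h.ne_zero) (abs_ne_zero.mpr hK.ne_zero)) (abs_ne_zero.mpr hMid.ne_zero),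
    Real.log_mul (abs_ne_zero.mpr h.ne_zero) (abs_ne_zero.mpr hK.ne_zero)]
  ring

/-- [folklore] **AGREEMENT WITH THE WHITENED ROUTE**: for a square whitening `N` with `N Mid Nᵀ = 1` (so `E := NF` has `EᵀE = FᵀMid⁻¹F` by
part 1 §1), the owner's `logZ_downdate` at `E` gives the SAME right-hand side:
`logZ (H − (NF)ᵀ(NF)) Q = logZ H Q − ½·log|det(Mid − FΓ₀Fᵀ)| + ½·log|det Mid|`. -/
theorem logZ_downdate_whiten (H : Matrix ν ν ℝ) (Q : Matrix μ ν ℝ) (F : Matrix κ ν ℝ) (Mid N : Matrix κ κ ℝ)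
    (h : IsUnit (kkt H Q).det) (hN : N * Mid * Nᵀ = 1) (hK : IsUnit (Mid - F * flucCov H Q * Fᵀ).det) :
    logZ (H - (N * F)ᵀ * (N * F)) Q
      = logZ H Q - (1 / 2 : ℝ) * Real.log |(Mid - F * flucCov H Q * Fᵀ).det| + (1 / 2 : ℝ) * Real.log |Mid.det| := by
  have hM : IsUnit (1 - (N * F) * flucCov H Q * (N * F)ᵀ).det := by
    rw [isUnit_iff_ne_zero]
    intro h0
    have h1 := det_one_sub_whiten_mul F (flucCov H Q) Mid N hN
    rw [h0, zero_mul] at h1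
    exact hK.ne_zero h1.symm
  rw [logZ_downdate H Q (N * F) h hM, log_abs_det_one_sub_whiten F (flucCov H Q) Mid N hN hK]
  ring

/-- [folklore] **THE THREE-PLUS-ONE-TERM FORM** for invertible `H` (E-FP-5-5 (1)'s organisation, `det M_B` side only):
`logZ (H − FᵀMid⁻¹F) Q = ((|ν| − |μ|)/2)·log 2π − ½log|det H| − ½log|det(QH⁻¹Qᵀ)| − ½log|det(Mid − FΓ₀Fᵀ)| + ½log|det Mid|` —
[unconstrained fine] + [coarse covariance] + [residual modes `K_C⁻¹`] + [the weight `Mid`]. -/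
theorem logZ_sub_deficit_three (H : Matrix ν ν ℝ) (Q : Matrix μ ν ℝ) (F : Matrix κ ν ℝ) (Mid : Matrix κ κ ℝ) (hH : IsUnit H.det)
    (h : IsUnit (kkt H Q).det) (hMid : IsUnit Mid.det) (hK : IsUnit (Mid - F * flucCov H Q * Fᵀ).det) :
    logZ (H - Fᵀ * Mid⁻¹ * F) Q
      = ((Fintype.card ν : ℝ) - Fintype.card μ) / 2 * Real.log (2 * Real.pi)
        - (1 / 2 : ℝ) * Real.log |H.det| - (1 / 2 : ℝ) * Real.log |(blockProp H Q).det|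
        - (1 / 2 : ℝ) * Real.log |(Mid - F * flucCov H Q * Fᵀ).det| + (1 / 2 : ℝ) * Real.log |Mid.det| := by
  have hP : (blockProp H Q).det ≠ 0 := by
    intro hz
    have hne : (kkt H Q).det ≠ 0 := h.ne_zero
    rw [det_kkt' H Q hH, hz, mul_zero, mul_zero] at hne
    exact hne rfl
  rw [logZ_sub_deficit H Q F Mid h hMid hK]
  unfold logZ
  rw [det_kkt' H Q hH, abs_mul, abs_mul, abs_pow, abs_neg, abs_one, one_pow, one_mul,
    Real.log_mul (abs_ne_zero.mpr hH.ne_zero) (abs_ne_zero.mpr hP)]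
  ring

/-! ## §3 E-FP-5-5's one line: a `Mid·L·Mid` factorisation of `K_C⁻¹` -/

/-- [folklore] `det (Mid·L·Mid) = det Mid² · det L`. -/
theorem det_mid_sandwich (Mid L : Matrix κ κ 𝕜) : (Mid * L * Mid).det = Mid.det ^ 2 * L.det := by
  rw [det_mul, det_mul]; ring

/-- [folklore] `log|det(Mid·L·Mid)| = 2·log|det Mid| + log|det L|` (both determinants nonzero). -/
theorem log_abs_det_mid_sandwich (Mid L : Matrix κ κ ℝ) (hMid : IsUnit Mid.det) (hL : IsUnit L.det) :
    Real.log |(Mid * L * Mid).det| = 2 * Real.log |Mid.det| + Real.log |L.det| := by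
  rw [det_mid_sandwich, abs_mul, abs_pow, Real.log_mul (pow_ne_zero 2 (abs_ne_zero.mpr hMid.ne_zero)) (abs_ne_zero.mpr hL.ne_zero),
    Real.log_pow]
  push_cast
  ring

/-- [folklore] **E-FP-5-5 (1), THE `det M_B` SIDE**: if `Mid − F·flucCov H Q·Fᵀ = Mid·L·Mid` (the reading's `K_C⁻¹ = Mid·L_C·Mid`) with `Mid`, `L`
invertible, then `logZ (H − FᵀMid⁻¹F) Q = logZ H Q − ½·log|det L| − ½·log|det Mid|` — the `−½log det Mid` which the constrained ghost's
`+½log det Mid` cancels (that half is `GhostDeterminantModel`'s, not here). -/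
theorem logZ_sub_deficit_of_factor (H : Matrix ν ν ℝ) (Q : Matrix μ ν ℝ) (F : Matrix κ ν ℝ) (Mid L : Matrix κ κ ℝ)
    (h : IsUnit (kkt H Q).det) (hMid : IsUnit Mid.det) (hL : IsUnit L.det) (hfac : Mid - F * flucCov H Q * Fᵀ = Mid * L * Mid) :
    logZ (H - Fᵀ * Mid⁻¹ * F) Q = logZ H Q - (1 / 2 : ℝ) * Real.log |L.det| - (1 / 2 : ℝ) * Real.log |Mid.det| := by
  have hK : IsUnit (Mid - F * flucCov H Q * Fᵀ).det := by
    rw [hfac, det_mid_sandwich]; exact (hMid.pow 2).mul hL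
  have hZ := logZ_sub_deficit H Q F Mid h hMid hK
  rw [hfac, log_abs_det_mid_sandwich Mid L hMid hL] at hZ
  rw [hZ]
  ring

/-- [folklore] The factor of §3 in part 1's letters: under (I2)'s hypotheses `Mid − FΓ₀Fᵀ = S₀ᵀG_C S₀`, so with `L := Mid⁻¹·S₀ᵀG_C S₀·Mid⁻¹`
(the reading's `L_C = (d^c)ᵀG_C d^c`, `S₀ = d^c·Mid`) the factorisation `Mid − FΓ₀Fᵀ = Mid·L·Mid` HOLDS. -/
theorem deficit_eq_mid_sandwich (H : Matrix ν ν 𝕜) (Q : Matrix μ ν 𝕜) (F : Matrix κ ν 𝕜) (Mid : Matrix κ κ 𝕜) (hH : IsUnit H.det)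
    (hP : IsUnit (blockProp H Q).det) (hHs : Hᵀ = H) (hF : F * H⁻¹ * Fᵀ = Mid) (hMid : IsUnit Mid.det) :
    Mid - F * flucCov H Q * Fᵀ
      = Mid * (Mid⁻¹ * ((Q * H⁻¹ * Fᵀ)ᵀ * (blockProp H Q)⁻¹ * (Q * H⁻¹ * Fᵀ)) * Mid⁻¹) * Mid := by
  rw [weight_sub_deficitCov_eq H Q F Mid hH hP hHs hF]
  set X := (Q * H⁻¹ * Fᵀ)ᵀ * (blockProp H Q)⁻¹ * (Q * H⁻¹ * Fᵀ)
  rw [← Matrix.mul_assoc Mid, ← Matrix.mul_assoc Mid, Matrix.mul_nonsing_inv Mid hMid, Matrix.one_mul,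
    Matrix.nonsing_inv_mul_cancel_right _ _ hMid]

end Summit.QuantumFields.BalabanUV.Beta.FP.ResidualModeDeterminant
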